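import Summits.BirchSwinnertonDyer.Rank1Residual.X2.GreenbergVatsalTateDatumRat
import Summits.BirchSwinnertonDyer.BirchSwinnertonDyer.Theorems.Rank1ResidualIntModelReduction
import Literature.NumberTheory.EllipticCurves.HasseWeilGoodReductionFrobeniusProofs
import Literature.NumberTheory.EllipticCurves.KernelReductionInertiaProofs
import Literature.NumberTheory.EllipticCurves.QuadraticTwistLocalPolynomialProofs
import Mathlib.NumberTheory.LegendreSymbol.Basic
import Mathlib.Algebra.QuadraticDiscriminant
import HarnessLib

/-!
# At an odd NON-SPLIT multiplicative prime `p` of `E/ℚ` an arithmetic Frobenius FLIPS `√γ(E)`: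
# `τ(t) = −t` for `t² = γ = −c₄/c₆` (so the unramified quadratic character `φ` of the Tate curve
# has `φ(Frob_p) = −1`), from "non-split ⟹ `−c₄c₆` is a non-square mod `p`" and Euler's criterion

HONEST FRAMING (cell `b2b-bsdres`, run/shared/lean/b2b/bsd-rank1-residual/, verbatim in every
file): the goal of the cell is to DELETE the COMBINATION-SHAPED residual classes of the
Birch–Swinnerton-Dyer formula for ALL analytic-rank `≤ 1` elliptic curves over `ℚ` — "full BSD
formula for every rank `≤ 1` curve in class `C`" assembled STRICTLY from published theorems — so
that the rank-`≤ 1` remainder becomes exactly the CONSTRUCTION-SHAPED classes, which are TYPED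
(missing-input `Prop`s), NOT attempted. This is not "finishing BSD". Sub-cell
`b2b-bsdres-eisenstein-p2` (CLASS-OWNERS row "X2"), gen 12: research route; NO CLAIM BEYOND STATED
CLASSES; nothing here changes a label. THEOREMS ONLY (no `def`, no named fact, nothing asserted).

WHY (X2-GAP §16.6 (P5), input of the `p ‖ N` analogue of gen 10's `GreenbergVatsalStrictAtP`). The
tree's named fact `Silverman1994_thmV53_corV54_tateUniformisation` (Silverman *ATAEC* V.5.2 (c),
5.3, 5.4) parametrises `E(K̄_v)` with the TWISTED equivariance `σ•Ψ(u) = χ(σ)Ψ(σu)`,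
`χ(σ) = σ(t)/t`, `t² = γ(E) = −c₄/c₆`; gen 12's `GreenbergVatsalTateDatumSign` shows that `D_v` acts
on the unramified quotient `D = E[p^∞]/C` through `χ` and that a `σ` FLIPPING `t` makes
`res σ − 1` surjective on `D`. For the cyclotomic-tower argument (`GreenbergVatsalStrictCore`) that
`σ` must be an ARITHMETIC FROBENIUS lying in `Gal(ℚ̄_p/ℚ_{∞,𝔭})`. THIS FILE proves that at an odd
prime `p` of NON-SPLIT multiplicative reduction of the globally minimal `E/ℚ` EVERY arithmetic
Frobenius `τ ∈ Γ_{ℚ_p}` (at a prime `𝔐` of `\bar ℤ_p`) flips `t`: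
* §1 the node-tangent quadratic `c₄T² + a₁c₄T − (54b₆ − 3b₂b₄ + a₂c₄)` of ANY Weierstrass
  equation has discriminant `−c₄c₆` (tree lemma `WeierstrassCurve.discrim_nodalTangents`);
* §2 **`not_isSquare_neg_c₄_mul_c₆_of_not_split`** — `p` odd, multiplicative and NOT split at `p`
  ⟹ `−c₄c₆ (E_ℤ)` is a NON-square mod `p` (a square discriminant gives a root of the node-tangent
  quadratic mod `p`, hence split reduction by the tree's
  `Rank1Residual.IntModel.hasSplitMultiplicativeReductionAtPrime_of_intModel_of_root`, Silverman
  VII.5.1(b)); `int_dvd_pow_div_two_add_one_of_not_split` — Euler's criterion: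
  `p ∣ (−c₄c₆)^{(p−1)/2} + 1`;
* §3 **`frob_smul_sqrt_gamma_eq_neg`** — for `t ∈ ℚ̄_v` with `t² = γ`, `τ` an arithmetic Frobenius:
  `τ•t = −t`. Proof: `t' = c₆ t` has `t'² = g = −c₄c₆ ∈ ℤ`, `|t'|_v = 1`, `τt' ≡ t'^p = t'·g^{(p−1)/2}
  ≡ −t' (mod 𝔐)`; `τt = ±t`, and `τt = t` would give `|2t'|_v < 1`, impossible for odd `p`.
  (`frob_apply_sqrt_gamma_ne`: `τ t ≠ t`.) This is "`K_v(√γ)/K_v` is the unramified QUADRATIC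
  extension at a non-split place" (Silverman *ATAEC* V Ex. 5.11 (b)) in the form the cell needs.

References: Silverman, *AEC* VII.5.1(b) (node tangents), *ATAEC* V.5.2–5.4, Ex. 5.11;
Greenberg–Vatsal 2000 §2 pp. 14–15 (`φ` "unramified quadratic character in the non-split case");
Ireland–Rosen Prop. 5.1.2 (Euler's criterion; Mathlib `ZMod.euler_criterion`).
-/

noncomputable section

open scoped Classical NNReal

open NumberField IsDedekindDomain Field Polynomial
open Literature.NumberTheory.EllipticCurves Literature.NumberTheory.GaloisRepresentations
  IsDedekindDomain.HeightOneSpectrum Rat.HeightOneSpectrum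
open WeierstrassCurve (minimalDiscriminantInt integralModelInt)

namespace Summit.BirchSwinnertonDyer.Rank1Residual.X2.GreenbergVatsalTateFrobeniusSign

/-! ## §1. (The discriminant of the node-tangent quadratic is `−c₄c₆`: tree lemma
`WeierstrassCurve.discrim_nodalTangents`, file `QuadraticTwistLocalPolynomialProofs`.) -/

/-! ## §2. Non-split ⟹ `−c₄c₆` is a non-square mod `p`; Euler's criterion -/

section NonSquare

variable (W : WeierstrassCurve ℚ) [W.IsElliptic] [W.IsGloballyMinimal] (p : ℕ) [hp : Fact p.Prime]

/-- **At an odd prime of NON-SPLIT multiplicative reduction, `−c₄c₆` of the global minimal model is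
a NON-SQUARE mod `p`.** If `−c₄c₆ ≡ s²`, the node-tangent quadratic mod `p` (leading coefficient
`c₄ ≢ 0`, discriminant `−c₄c₆` by `WeierstrassCurve.discrim_nodalTangents`) has the root
`(−a₁c₄ + s)/(2c₄)`, so the reduction is split (tree:
`IntModel.hasSplitMultiplicativeReductionAtPrime_of_intModel_of_root`).
[cite: SilvermanAEC2009, VII.5 Prop. 5.1(b)] -/
theorem not_isSquare_neg_c₄_mul_c₆_of_not_split (hp2 : p ≠ 2)
    (hmult : W.HasMultiplicativeReductionAtPrime p) (hns : ¬ W.HasSplitMultiplicativeReductionAtPrime p) :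
    ¬ IsSquare ((-((integralModelInt W).c₄ * (integralModelInt W).c₆) : ℤ) : ZMod p) := by
  obtain ⟨hΔ, hc₄⟩ := Additive.dvd_and_not_dvd_c₄_of_hasMultiplicativeReductionAtPrime W p hmult
  rintro ⟨s, hs⟩
  apply hns
  set E₀ := integralModelInt W with hE₀
  have hΔ' : (p : ℤ) ∣ E₀.Δ := by rw [hE₀]; exact hΔ
  haveI : NeZero (2 : ZMod p) := ⟨by
    rw [show (2 : ZMod p) = ((2 : ℕ) : ZMod p) by norm_cast, Ne, ZMod.natCast_eq_zero_iff]
    intro h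
    exact hp2 ((Nat.prime_dvd_prime_iff_eq hp.out Nat.prime_two).mp h)⟩
  have hc₄' : (E₀.c₄ : ZMod p) ≠ 0 := by
    rw [Ne, ZMod.intCast_zmod_eq_zero_iff_dvd]; exact hc₄
  -- the discriminant of the node-tangent quadratic mod `p` is `-c₄c₆ = s * s`
  set I := E₀.map (Int.castRingHom (ZMod p)) with hI
  have hdisc : discrim (E₀.c₄ : ZMod p) ((E₀.a₁ : ZMod p) * (E₀.c₄ : ZMod p))
      (-(54 * (E₀.b₆ : ZMod p) - 3 * (E₀.b₂ : ZMod p) * (E₀.b₄ : ZMod p) +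
        (E₀.a₂ : ZMod p) * (E₀.c₄ : ZMod p))) = s * s := by
    have h := WeierstrassCurve.discrim_nodalTangents I
    simp only [hI, WeierstrassCurve.map_c₄, WeierstrassCurve.map_c₆, WeierstrassCurve.map_b₂,
      WeierstrassCurve.map_b₄, WeierstrassCurve.map_b₆, WeierstrassCurve.map_a₁,
      WeierstrassCurve.map_a₂, eq_intCast] at h
    rw [h, ← hs]
    push_cast
    ring
  obtain ⟨x, hx⟩ := exists_quadratic_eq_zero hc₄' ⟨s, hdisc⟩
  refine BirchSwinnertonDyer.Rank1Residual.IntModel.hasSplitMultiplicativeReductionAtPrime_of_intModel_of_root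
    (W := W) (E₀ := E₀) hE₀.symm p hΔ' hc₄ ⟨x, ?_⟩
  linear_combination hx

/-- **Euler's criterion at a non-split prime**: `p ∣ (−c₄c₆)^{(p−1)/2} + 1` (`p` odd, `p ∤ c₄c₆`,
`−c₄c₆` a non-square mod `p`; Mathlib `ZMod.euler_criterion`, `ZMod.pow_div_two_eq_neg_one_or_one`).
[cite: SilvermanAEC2009, VII.5 Prop. 5.1(b)] -/
theorem int_dvd_pow_div_two_add_one_of_not_split (hp2 : p ≠ 2)
    (hmult : W.HasMultiplicativeReductionAtPrime p) (hns : ¬ W.HasSplitMultiplicativeReductionAtPrime p) :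
    (p : ℤ) ∣ (-((integralModelInt W).c₄ * (integralModelInt W).c₆)) ^ (p / 2) + 1 := by
  have hnsq := not_isSquare_neg_c₄_mul_c₆_of_not_split W p hp2 hmult hns
  obtain ⟨-, hc₄⟩ := Additive.dvd_and_not_dvd_c₄_of_hasMultiplicativeReductionAtPrime W p hmult
  have hc₆ := GreenbergVatsalTateDatumRat.not_dvd_c₆_of_hasMultiplicativeReductionAtPrime W hmult
  have hp' : Prime (p : ℤ) := Nat.prime_iff_prime_int.mp hp.out
  have hg : ((-((integralModelInt W).c₄ * (integralModelInt W).c₆) : ℤ) : ZMod p) ≠ 0 := by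
    rw [Ne, ZMod.intCast_zmod_eq_zero_iff_dvd, dvd_neg]
    intro h
    rcases hp'.dvd_or_dvd h with h4 | h6
    · exact hc₄ h4
    · exact hc₆ h6
  have hpow : ((-((integralModelInt W).c₄ * (integralModelInt W).c₆) : ℤ) : ZMod p) ^ (p / 2) = -1 := by
    rcases ZMod.pow_div_two_eq_neg_one_or_one p hg with h | h
    · exact absurd ((ZMod.euler_criterion p hg).mpr h) hnsq
    · exact h
  rw [← ZMod.intCast_zmod_eq_zero_iff_dvd]
  push_cast at hpow ⊢
  rw [hpow, neg_add_cancel]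

end NonSquare

/-! ## §3. The arithmetic Frobenius flips `√γ` at a non-split odd `p ‖ N` -/

section Flip

variable (W : WeierstrassCurve ℚ) [W.IsElliptic] [W.IsGloballyMinimal] {p : ℕ} [hp : Fact p.Prime]
  {v : HeightOneSpectrum (𝓞 ℚ)}

/-- **An arithmetic Frobenius FLIPS `√γ(E)` at an odd prime of non-split multiplicative
reduction.** For the globally minimal `E/ℚ`, `p` odd with `E` multiplicative and NOT split at `p`,
`v ∋ p`, `𝔐` a prime of the local absolute integers `\bar 𝓞_v` above `𝓂_v`, `τ ∈ Γ_{ℚ_v}` an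
arithmetic Frobenius at `𝔐` (`τ x ≡ x^p (mod 𝔐)`), and `t ∈ ℚ̄_v` with `t² = γ = −c₄/c₆`:
`τ(t) = −t`. Proof: `c₄`, `c₆` are `p`-units (Silverman VII.5.1(b)), `t' = c₆t` is a `v`-adic unit
with `t'² = g = −c₄c₆ ∈ ℤ`; `τt' ≡ t'^p = t'·g^{(p−1)/2} ≡ −t' (mod 𝔐)` by Euler's criterion
(`int_dvd_pow_div_two_add_one_of_not_split`); and `τt = ±t` with `τt = t` forcing
`|2t'|_v < 1`, absurd for odd `p`. Equivalently `ℚ_v(√γ)` is the unramified QUADRATIC extension of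
`ℚ_v` (Silverman *ATAEC* V Ex. 5.11 (b); gen 9 `GreenbergVatsalTateDatumRat.inertia_fix_sqrt_gamma`
gave the inertial half), i.e. the character `φ` of GV pp. 14–15 has `φ(Frob) = −1`.
[cite: SilvermanATAEC1994, Ch. V Lemma 5.2 (c), Thm. 5.3 (a),(b), Cor. 5.4 (held copy PDF pp. 406–410)]
[cite: SilvermanAEC2009, VII.5 Prop. 5.1(b)] [cite: GreenbergVatsal2000, §2 pp. 14–15] -/
theorem frob_smul_sqrt_gamma_eq_neg (hp2 : p ≠ 2) (hmult : W.HasMultiplicativeReductionAtPrime p)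
    (hns : ¬ W.HasSplitMultiplicativeReductionAtPrime p) (hpv : ((p : ℕ) : 𝓞 ℚ) ∈ v.asIdeal)
    {𝔐 : Ideal v.localAbsIntegers} (h𝔐 : 𝔐 ∈ v.localPrimesAbove)
    {τ : absoluteGaloisGroup (v.adicCompletion ℚ)}
    (hτ : IsArithFrobAt (v.adicCompletionIntegers ℚ) τ 𝔐)
    (t : AlgebraicClosure (v.adicCompletion ℚ))
    (ht : t ^ 2 = algebraMap (v.adicCompletion ℚ) (AlgebraicClosure (v.adicCompletion ℚ))
      (algebraMap ℚ (v.adicCompletion ℚ) (-(W.c₄ / W.c₆)))) :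
    τ • t = -t := by
  obtain ⟨w, hw⟩ := v.exists_spectralValuation
  obtain ⟨-, hc₄⟩ := Additive.dvd_and_not_dvd_c₄_of_hasMultiplicativeReductionAtPrime W p hmult
  have hc₆ := GreenbergVatsalTateDatumRat.not_dvd_c₆_of_hasMultiplicativeReductionAtPrime W hmult
  haveI : CharZero (AlgebraicClosure (v.adicCompletion ℚ)) :=
    charZero_of_injective_algebraMap (algebraMap ℚ (AlgebraicClosure (v.adicCompletion ℚ))).injective
  -- `γ` in `ℚ̄_v`
  have h4 : W.c₄ = ((integralModelInt W).c₄ : ℚ) := by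
    conv_lhs => rw [← WeierstrassCurve.map_integralModelInt W]
    rw [WeierstrassCurve.map_c₄, eq_intCast]
  have h6 : W.c₆ = ((integralModelInt W).c₆ : ℚ) := by
    conv_lhs => rw [← WeierstrassCurve.map_integralModelInt W]
    rw [WeierstrassCurve.map_c₆, eq_intCast]
  have hγ : algebraMap (v.adicCompletion ℚ) (AlgebraicClosure (v.adicCompletion ℚ))
      (algebraMap ℚ (v.adicCompletion ℚ) (-(W.c₄ / W.c₆))) =
      -((((integralModelInt W).c₄ : ℤ) : AlgebraicClosure (v.adicCompletion ℚ)) /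
        (((integralModelInt W).c₆ : ℤ) : AlgebraicClosure (v.adicCompletion ℚ))) := by
    rw [← IsScalarTower.algebraMap_apply ℚ (v.adicCompletion ℚ)
      (AlgebraicClosure (v.adicCompletion ℚ)), h4, h6, map_neg, map_div₀, map_intCast, map_intCast]
  have hc60 : (((integralModelInt W).c₆ : ℤ) : AlgebraicClosure (v.adicCompletion ℚ)) ≠ 0 := by
    rw [Int.cast_ne_zero]; intro h0; exact hc₆ (by rw [h0]; exact dvd_zero _)
  -- `t' = c₆ t`, `t'² = g = -c₄c₆`
  obtain ⟨t', ht'def⟩ : ∃ t' : AlgebraicClosure (v.adicCompletion ℚ),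
      t' = (((integralModelInt W).c₆ : ℤ) : AlgebraicClosure (v.adicCompletion ℚ)) * t := ⟨_, rfl⟩
  have ht'2 : t' ^ 2 = (((-((integralModelInt W).c₄ * (integralModelInt W).c₆)) : ℤ) :
      AlgebraicClosure (v.adicCompletion ℚ)) := by
    rw [ht'def, mul_pow, ht, hγ]
    push_cast
    field_simp
  -- valuations: `|c₆| = |t| = |t'| = 1`
  have hw4 : w (((integralModelInt W).c₄ : ℤ) : AlgebraicClosure (v.adicCompletion ℚ)) = 1 :=
    spectralValuation_intCast_eq_one_of_natCast_mem hpv hw hc₄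
  have hw6 : w (((integralModelInt W).c₆ : ℤ) : AlgebraicClosure (v.adicCompletion ℚ)) = 1 :=
    spectralValuation_intCast_eq_one_of_natCast_mem hpv hw hc₆
  have hwt2 : w t ^ 2 = 1 := by
    rw [← map_pow, ht, hγ, Valuation.map_neg, map_div₀, hw4, hw6, div_one]
  have hwt : w t = 1 := by
    rcases lt_trichotomy (w t) 1 with h | h | h
    · exact absurd hwt2 (ne_of_lt (pow_lt_one₀ zero_le h two_ne_zero))
    · exact h
    · exact absurd hwt2 (ne_of_gt (one_lt_pow₀ h two_ne_zero))
  have hwt' : w t' = 1 := by rw [ht'def, map_mul, hw6, hwt, one_mul]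
  -- `t'` is a local absolute integer; apply the Frobenius congruence to it
  have ht'mem : t' ∈ v.localAbsIntegers := (mem_localAbsIntegers_iff_spectralValuation hw).2 hwt'.le
  have hcard : Nat.card (v.adicCompletionIntegers ℚ ⧸
      Ideal.under (v.adicCompletionIntegers ℚ) 𝔐) = p := by
    rw [natCard_quotient_under_eq_of_mem_localPrimesAbove v h𝔐,
      WeierstrassCurve.natCard_residueField_adicCompletionIntegers v,
      Rat.HeightOneSpectrum.primesEquiv_eq_of_natCast_mem v hp.out hpv]
  have hfrob : w (τ • t' - t' ^ p) < 1 := by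
    have h := hτ ⟨t', ht'mem⟩
    rw [hcard] at h
    exact (mem_iff_spectralValuation_lt_one hw h𝔐).1 h
  -- Euler: `t'^p = t' * g^{(p-1)/2} = t' * (p k) - t'`
  obtain ⟨k, hk⟩ := int_dvd_pow_div_two_add_one_of_not_split W p hp2 hmult hns
  have hpodd : p = 2 * (p / 2) + 1 :=
    (Nat.two_mul_div_two_add_one_of_odd (hp.out.odd_of_ne_two hp2)).symm
  have htp : t' ^ p = t' * ((p : AlgebraicClosure (v.adicCompletion ℚ)) *
      (k : AlgebraicClosure (v.adicCompletion ℚ))) - t' := by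
    have e1 : t' ^ p = t' * (t' ^ 2) ^ (p / 2) := by
      conv_lhs => rw [hpodd]
      rw [pow_succ, pow_mul, mul_comm]
    have e2 : ((((-((integralModelInt W).c₄ * (integralModelInt W).c₆)) : ℤ) :
        AlgebraicClosure (v.adicCompletion ℚ))) ^ (p / 2) =
        (p : AlgebraicClosure (v.adicCompletion ℚ)) * (k : AlgebraicClosure (v.adicCompletion ℚ))
          - 1 := by
      have := congrArg (fun z : ℤ ↦ (z : AlgebraicClosure (v.adicCompletion ℚ))) hk
      push_cast at this ⊢
      linear_combination this
    rw [e1, ht'2, e2]; ring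
  -- hence `|τ t' + t'| < 1`
  have hwp : w (p : AlgebraicClosure (v.adicCompletion ℚ)) < 1 := spectralValuation_natCast_lt_one hw hpv
  have hwk : w (k : AlgebraicClosure (v.adicCompletion ℚ)) ≤ 1 :=
    (mem_localAbsIntegers_iff_spectralValuation hw).1 (intCast_mem v.localAbsIntegers k)
  have hsum : w (τ • t' + t') < 1 := by
    have e : τ • t' + t' = (τ • t' - t' ^ p) + t' * ((p : AlgebraicClosure (v.adicCompletion ℚ)) *
        (k : AlgebraicClosure (v.adicCompletion ℚ))) := by rw [htp]; ring
    rw [e]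
    refine lt_of_le_of_lt (Valuation.map_add w _ _) (max_lt hfrob ?_)
    rw [map_mul, hwt', one_mul, map_mul]
    calc w (p : AlgebraicClosure (v.adicCompletion ℚ)) * w (k : AlgebraicClosure (v.adicCompletion ℚ))
        ≤ w (p : AlgebraicClosure (v.adicCompletion ℚ)) * 1 := by gcongr
      _ < 1 := by rw [mul_one]; exact hwp
  -- `τ t = ± t`
  have hsq : (τ • t) ^ 2 = t ^ 2 := by
    rw [Field.absoluteGaloisGroup.smul_def, ← map_pow, ht, AlgEquiv.commutes]
  have hcases : τ • t = t ∨ τ • t = -t := by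
    have h0 : (τ • t - t) * (τ • t + t) = 0 := by
      have : (τ • t - t) * (τ • t + t) = (τ • t) ^ 2 - t ^ 2 := by ring
      rw [this, hsq, sub_self]
    rcases mul_eq_zero.mp h0 with h | h
    · exact Or.inl (sub_eq_zero.mp h)
    · exact Or.inr (eq_neg_of_add_eq_zero_left h)
  have hτc6 : τ • (((integralModelInt W).c₆ : ℤ) : AlgebraicClosure (v.adicCompletion ℚ)) =
      (((integralModelInt W).c₆ : ℤ) : AlgebraicClosure (v.adicCompletion ℚ)) := by
    rw [Field.absoluteGaloisGroup.smul_def, map_intCast]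
  rcases hcases with h | h
  · exfalso
    have hτt' : τ • t' = t' := by rw [ht'def, smul_mul', hτc6, h]
    have h2 : ¬ (p : ℤ) ∣ (2 : ℤ) := by
      intro hd
      have : p ∣ 2 := by exact_mod_cast hd
      exact hp2 ((Nat.prime_dvd_prime_iff_eq hp.out Nat.prime_two).mp this)
    have hw2 : w ((2 : ℤ) : AlgebraicClosure (v.adicCompletion ℚ)) = 1 :=
      spectralValuation_intCast_eq_one_of_natCast_mem hpv hw h2
    rw [hτt', ← two_mul, show (2 : AlgebraicClosure (v.adicCompletion ℚ)) =
      ((2 : ℤ) : AlgebraicClosure (v.adicCompletion ℚ)) by norm_cast, map_mul, hw2, hwt',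
      one_mul] at hsum
    exact lt_irrefl _ hsum
  · exact h

/-- The same with Mathlib's `AlgEquiv` spelling of the action (`toAlgEquiv τ t = −t`), as consumed
by `GreenbergVatsalTateDatumSign` (hypothesis `σ t ≠ t`). [cite: GreenbergVatsal2000, §2 pp. 14–15]
[cite: SilvermanATAEC1994, Ch. V Lemma 5.2 (c), Thm. 5.3 (a),(b), Cor. 5.4 (held copy PDF pp. 406–410)] -/
theorem frob_apply_sqrt_gamma_ne (hp2 : p ≠ 2) (hmult : W.HasMultiplicativeReductionAtPrime p)
    (hns : ¬ W.HasSplitMultiplicativeReductionAtPrime p) (hpv : ((p : ℕ) : 𝓞 ℚ) ∈ v.asIdeal)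
    {𝔐 : Ideal v.localAbsIntegers} (h𝔐 : 𝔐 ∈ v.localPrimesAbove)
    {τ : absoluteGaloisGroup (v.adicCompletion ℚ)}
    (hτ : IsArithFrobAt (v.adicCompletionIntegers ℚ) τ 𝔐)
    (t : AlgebraicClosure (v.adicCompletion ℚ)) (ht0 : t ≠ 0)
    (ht : t ^ 2 = algebraMap (v.adicCompletion ℚ) (AlgebraicClosure (v.adicCompletion ℚ))
      (algebraMap ℚ (v.adicCompletion ℚ) (-(W.c₄ / W.c₆)))) :
    Field.absoluteGaloisGroup.toAlgEquiv (v.adicCompletion ℚ) τ t ≠ t := by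
  rw [← Field.absoluteGaloisGroup.smul_def, frob_smul_sqrt_gamma_eq_neg W hp2 hmult hns hpv h𝔐 hτ t ht]
  haveI : CharZero (AlgebraicClosure (v.adicCompletion ℚ)) :=
    charZero_of_injective_algebraMap (algebraMap ℚ (AlgebraicClosure (v.adicCompletion ℚ))).injective
  intro h
  have h2 : (2 : AlgebraicClosure (v.adicCompletion ℚ)) * t = 0 := by linear_combination -h
  rcases mul_eq_zero.mp h2 with h | h
  · exact two_ne_zero h
  · exact ht0 h

end Flip

end Summit.BirchSwinnertonDyer.Rank1Residual.X2.GreenbergVatsalTateFrobeniusSign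

end
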